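import Summits.BirchSwinnertonDyer.Rank1Residual.Additive.X4RankZeroKatoBound
import Summits.BirchSwinnertonDyer.Rank1Residual.Additive.X4RankZeroLowerCertificateNoLemma20
import Literature.NumberTheory.EllipticCurves.CongruenceVisibilityLocalFactors
import Literature.NumberTheory.EllipticCurves.Rank1Residual.Typed.X11Visibility
import Literature.NumberTheory.EllipticCurves.Rank1Residual.Typed.X5DescentSelmer
import HarnessLib

/-!
# X4 ∧ `r = 0`: `BSD(E,p)` from a VISIBLE element of `Ш(E)[p]` — the binder-light visibility ENDs
# (cell `b2b-bsdres`, team n1011, ROW T-VIS3 = r1 ROUTE-1 §40.3 (d) / R1-74, lead R5-77 (e) / R5-78;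
# skeleton `cells/n1011/skel/T-VIS3.md` d9825bf73f956df4 (owner n1011-p04); T-VIS3 SUPPORT FILE, seat p03
# GEN 9, filed at the owner's request (p04, HOME/INBOX 2026-08-21T20:31Z))

HONEST FRAMING (cell `b2b-bsdres`, run/shared/lean/b2b/bsd-rank1-residual/, verbatim in every
file): the goal of the cell is to DELETE the COMBINATION-SHAPED residual classes of the
Birch–Swinnerton-Dyer formula for ALL analytic-rank `≤ 1` elliptic curves over `ℚ` — "full BSD
formula for every rank `≤ 1` curve in class `C`" assembled STRICTLY from published theorems — so
that the rank-`≤ 1` remainder becomes exactly the CONSTRUCTION-SHAPED classes, which are TYPED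
(missing-input `Prop`s), NOT attempted. This is not "finishing BSD". Team n1011 (N10/N11, the
additive block `X4 ∧ p = 3`): research route; END theorems only (no definition, no named fact, no
`sorry`); PER-PAIR certificate SHAPES, not a class theorem; nothing booked; no mark / label moved;
the ENDs below CLOSE NOTHING by themselves — the congruence certificate (`θ`, `hθ`), the partner's
rank-`2` witness (`hrank`) and the local `p`-torsion counts (`hloc`) are per-row INPUTS (EVIDENCE until
kernel-certified; the KO/Sturm road is p07/r2's, records p18/x11c's).

## What and why

Route planner 1 (§40, V40 / T-VIS3): 42 of the 74 LOWER-open rank-`0` rows of N11 have a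
`3`-congruent partner `E′` of rank `2` (Cremona–Mazur Table 1 pairs among them), and the tree ALREADY
holds the visibility count of Cremona–Mazur §3 / Agashe–Stein Thm. 3.1 "made unconditional at `p ∣ N`"
(x11a/x11c, `Literature/NumberTheory/EllipticCurves/CongruenceVisibility*.lean`:
`WeierstrassCurve.exists_sha_ne_zero_of_congr_of_rank` — NO hypothesis on the reduction at `p`, so an
ADDITIVE `p` is allowed).  n1011-p04's `GaloisImage/VisibleLowerBoundThree.lean` (T-VIS3 (ii)) wires
that count into n1011-p18's Kurihara-record sockets (`…_of_sq_dvd_card_sha`, with the optimal datum,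
`N ≤ 130000` and the level-zero unit `hunit₁`).  THIS file gives the two BINDER-LIGHT ENDs over
additive-p1's X4 rank-`0` sockets instead — no Kurihara value, no port, no PT / EP family, and on the
potentially multiplicative rows NO Manin datum and NO tower:

* `X4RankZero.bsdp_of_congr_of_rank_two_of_kato` — X4 ∧ `r = 0`, potentially GOOD at an odd `p`,
  tower `ρ_{E,p^n}` onto, `p ∤ ∏ c_ℓ`, a parametrisation datum with `p ∤ c_D`, `ord_p #Ш_an ≤ 2`
  (`shaAn W = q`, `padicValRat p q ≤ 2`), and a C-VIS certificate {`E′`, `θ : E′[p] ≃ E[p]`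
  `Γ_ℚ`-equivariant, `S` (outside: both good, `v ∤ p`), `2 ≤ rank E′(ℚ)`, `E′(ℚ_v)[p] = 0` on `S`}
  ⟹ `BSDp W p`: `exists_sha_ne_zero_of_congr_of_rank` → `Typed.dvd_shaOrder_of_exists_torsion` →
  Cassels–Tate (`Typed.missingLowerBoundAt_of_casselsTate_of_pow_dvd`, `k = 1`) →
  `X4RankZero.bsdp_of_missingLowerBoundAt_of_kato` (Kato 2004 Thm. 14.5 (3), additive-p1
  `Additive/X4RankZeroKatoBound.lean`);
* `X4RankZero.bsdp_three_potMult_of_congr_of_rank_two` — X4 ∧ `r = 0`, potentially MULTIPLICATIVE at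
  `3` (`ord₃ j < 0`), `ρ̄_{E,3}` onto, `ord₃ #Ш_an ≤ 2`, the same certificate at `p = 3` ⟹ `BSDp W 3`:
  the visible class has a preimage in `Sel^(3)(E/ℚ)` (`Typed.exists_selmerToSha_eq`, Silverman X.4.2
  (a)), so `Sel^(3)(E/ℚ) ≠ ⊥`, and additive-p1's
  `X4RankZero.bsdp_three_potMult_of_selmerGroup_ne_bot_noL20` (Delbourgo (M) + Kato's half
  eigen-ideal + Cassels–Tate, `Additive/X4RankZeroLowerCertificateNoLemma20.lean`) concludes.

`E(ℚ)` finite (Gross–Zagier–Kolyvagin at `r_an = 0`, `Typed.finite_point_of_analyticRank_eq_zero`)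
and `p ∤ #E(ℚ)` (irreducibility, `Typed.coprime_natCard_point_of_irr`) are discharged inside.
Nothing is booked; class X4 stays CONSTRUCTION-SHAPED; r1's "36 of 42 rows in shape" is EVIDENCE.

References: J. E. Cremona, B. Mazur, Experiment. Math. 9 (2000) §3, Table 1 [CremonaMazur2000];
A. Agashe, W. Stein, J. Number Theory 97 (2002) Thm. 3.1 [AgasheStein2002]; K. Kato, Astérisque 295
(2004) Thm. 14.5 (3) [Kato2004Asterisque]; D. Delbourgo (1998) Prop. 4 [Delbourgo1998]; J. H.
Silverman, AEC (2009) X.4.2 (a), X.4.14 [SilvermanAEC2009]; R. L. Miller, LMS J. Comput. Math. 14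
(2011) Def. 1.1 [Miller2011LMS]; cells/n1011/ROUTE-1.md §40.3 (d), skel/T-VIS3.md.
-/

noncomputable section

open scoped Classical

open WeierstrassCurve Literature.NumberTheory.EllipticCurves
  Literature.NumberTheory.EllipticCurves.ModularForms
  Literature.NumberTheory.EllipticCurves.Rank1Residual
  Literature.NumberTheory.EllipticCurves.Rank1Residual.Typed
  NumberField IsDedekindDomain

namespace Summit.BirchSwinnertonDyer.Rank1Residual.Additive

/-- **X4 ∧ `r = 0`, potentially GOOD at an odd `p`, `ord_p #Ш_an ≤ 2`: `BSD(E,p)` from Kato's UPPER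
half and a VISIBLE element of `Ш(E)[p]` supplied by a `p`-congruent curve of rank `≥ 2`** (no Euler-system
lower bound, no port).  Composition: `exists_sha_ne_zero_of_congr_of_rank` (Cremona–Mazur / Agashe–Stein
count, no condition at `p`) → `dvd_shaOrder_of_exists_torsion` → Cassels–Tate
(`missingLowerBoundAt_of_casselsTate_of_pow_dvd`, `k = 1`) → `X4RankZero.bsdp_of_missingLowerBoundAt_of_kato`.
[cite: CremonaMazur2000, §3 and Table 1] [cite: AgasheStein2002, Thm. 3.1]
[cite: Kato2004Asterisque, Thm. 14.5 (3) (p. 236)] [cite: SilvermanAEC2009, Thm. X.4.14] -/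
theorem X4RankZero.bsdp_of_congr_of_rank_two_of_kato
    (hKato : Kato2004.rankZero_padicValNat_sha_le_of_additive_potGood_of_imageContainsSL2)
    (hCT : exists_casselsTate_pairing (K := ℚ))
    (hGZK : rank_eq_analyticRank_of_analyticRank_le_one) (hmod : hasEntireLFunction_rat)
    (W : WeierstrassCurve ℚ) [W.IsElliptic] [W.IsGloballyMinimal] (p : ℕ) [Fact p.Prime] (hp : p ≠ 2)
    (hr : W.analyticRank = 0) (hX : ClassX4 W p) (hpot : 0 ≤ padicValRat p W.j)
    (hsurj : ∀ n : ℕ, W.HasSurjectiveModNGaloisRep (p ^ n : ℕ)) (htam : ¬ p ∣ W.tamagawaProduct)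
    {N : ℕ} [NeZero N] (D : ModularParametrizationData W N) (hc : ¬ (p : ℤ) ∣ D.maninConstant)
    {q : ℚ} (hq : shaAn W = (q : ℂ)) (hv : padicValRat p q ≤ 2)
    (W' : WeierstrassCurve ℚ) [W'.IsElliptic]
    (θ : geomTorsion W' (p : ℤ) ≃+ geomTorsion W (p : ℤ))
    (hθ : ∀ (σ : Field.absoluteGaloisGroup ℚ) (P : geomTorsion W' (p : ℤ)), θ (σ • P) = σ • θ P)
    (hrank : 2 ≤ W'.mordellWeilRank) (S : Finset (HeightOneSpectrum (𝓞 ℚ)))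
    (hS : ∀ v : HeightOneSpectrum (𝓞 ℚ), v ∉ S →
      W.HasGoodReductionAt v ∧ W'.HasGoodReductionAt v ∧ (p : 𝓞 ℚ) ∉ v.asIdeal)
    (hloc : ∀ v ∈ S, Nat.card (nsmulAddMonoidHom p :
      (W'.baseChange (v.adicCompletion ℚ)).toAffine.Point →+ _).ker = 1) :
    BSDp W p := by
  haveI : Finite W.toAffine.Point := finite_point_of_analyticRank_eq_zero W hGZK hr
  have hirr : Irr W p :=
    hasIrreducibleModPGaloisRep_of_hasSurjectiveModNGaloisRep W p (by simpa using hsurj 1)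
  have hrank' : Module.finrank ℚ ℚ + 1 ≤ W'.mordellWeilRank := by rwa [Module.finrank_self]
  have hvis := W.exists_sha_ne_zero_of_congr_of_rank W' hp θ hθ S hS ‹_›
    (coprime_natCard_point_of_irr W p hirr) hrank' hloc
  have hlow : MissingLowerBoundAt W p :=
    missingLowerBoundAt_of_casselsTate_of_pow_dvd W p hCT (hGZK W (by omega)).2 hq (k := 1)
      (by simpa using hv) (by simpa using dvd_shaOrder_of_exists_torsion W p hvis)
  exact X4RankZero.bsdp_of_missingLowerBoundAt_of_kato W p hKato hGZK hmod hr hX hpot hsurj htam D hc hlow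

/-- **X4 ∧ `r = 0`, potentially MULTIPLICATIVE at `3`, `ρ̄_{E,3}` onto, `ord₃ #Ш_an ≤ 2`: `BSD(E,3)`
from the (M)-chain UPPER half (Delbourgo (M) + Kato's half eigen-ideal) and a VISIBLE element of `Ш(E)[3]`
supplied by a `3`-congruent curve of rank `≥ 2`** — no Manin datum, no port, no Kurihara level.
Composition: `exists_sha_ne_zero_of_congr_of_rank` → `exists_selmerToSha_eq` (`Sel^(3) ↠ Ш[3]`, so
`Sel^(3)(E/ℚ) ≠ ⊥`) → additive-p1's `X4RankZero.bsdp_three_potMult_of_selmerGroup_ne_bot_noL20`.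
[cite: CremonaMazur2000, §3 and Table 1] [cite: AgasheStein2002, Thm. 3.1]
[cite: Delbourgo1998, Prop. 4 (p. 144)] [cite: SilvermanAEC2009, Thm. X.4.2 (a) and X.4.14] -/
theorem X4RankZero.bsdp_three_potMult_of_congr_of_rank_two
    (hKatoS : Kato2004.rankZero_padicValNat_sha_le_sub_localTamagawa_of_additive_potGood_of_imageContainsSL2)
    (hDel : Delbourgo1998.prop4_rankZero_pow_dvd_constantCoeff)
    (hGZK : rank_eq_analyticRank_of_analyticRank_le_one) (hmod : hasEntireLFunction_rat)
    (hmodD : nonempty_modularParametrizationData)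
    (hKatoχ : Wuthrich2014.kato_halfEigenCharIdeal_dvd_cyclotomicPrime_of_surjective)
    (hCT : exists_casselsTate_pairing (K := ℚ))
    (W : WeierstrassCurve ℚ) [W.IsElliptic] [W.IsGloballyMinimal] (hr : W.analyticRank = 0)
    (hX : haveI : Fact (Nat.Prime 3) := ⟨Nat.prime_three⟩; ClassX4 W 3)
    (hsurj : W.HasSurjectiveModNGaloisRep 3) (hj : padicValRat 3 W.j < 0)
    {q : ℚ} (hq : shaAn W = (q : ℂ)) (hv : padicValRat 3 q ≤ 2)
    (W' : WeierstrassCurve ℚ) [W'.IsElliptic]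
    (θ : geomTorsion W' ((3 : ℕ) : ℤ) ≃+ geomTorsion W ((3 : ℕ) : ℤ))
    (hθ : ∀ (σ : Field.absoluteGaloisGroup ℚ) (P : geomTorsion W' ((3 : ℕ) : ℤ)),
      θ (σ • P) = σ • θ P)
    (hrank : 2 ≤ W'.mordellWeilRank) (S : Finset (HeightOneSpectrum (𝓞 ℚ)))
    (hS : ∀ v : HeightOneSpectrum (𝓞 ℚ), v ∉ S →
      W.HasGoodReductionAt v ∧ W'.HasGoodReductionAt v ∧ ((3 : ℕ) : 𝓞 ℚ) ∉ v.asIdeal)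
    (hloc : ∀ v ∈ S, Nat.card (nsmulAddMonoidHom 3 :
      (W'.baseChange (v.adicCompletion ℚ)).toAffine.Point →+ _).ker = 1) :
    haveI : Fact (Nat.Prime 3) := ⟨Nat.prime_three⟩
    BSDp W 3 := by
  haveI : Fact (Nat.Prime 3) := ⟨Nat.prime_three⟩
  haveI : Finite W.toAffine.Point := finite_point_of_analyticRank_eq_zero W hGZK hr
  have hirr : Irr W 3 := hasIrreducibleModPGaloisRep_of_hasSurjectiveModNGaloisRep W 3 hsurj
  have hrank' : Module.finrank ℚ ℚ + 1 ≤ W'.mordellWeilRank := by rwa [Module.finrank_self]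
  obtain ⟨c, hc0, hc3⟩ := W.exists_sha_ne_zero_of_congr_of_rank W' (by norm_num) θ hθ S hS ‹_›
    (coprime_natCard_point_of_irr W 3 hirr) hrank' hloc
  -- `Sel^(3)(E/ℚ) ↠ Ш(E/ℚ)[3]`: a preimage of the visible class is a non-zero Selmer element
  obtain ⟨z, hz⟩ := exists_selmerToSha_eq W (n := ((3 : ℕ) : ℤ)) (by norm_num) c (by exact_mod_cast hc3)
  have hSel : W.selmerGroup ((3 : ℕ) : ℤ) ≠ ⊥ := by
    intro hbot
    have hmem : (z : W.galH1Torsion ((3 : ℕ) : ℤ)) ∈ (⊥ : AddSubgroup _) := hbot ▸ z.2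
    have hz0 : z = 0 := Subtype.ext ((AddSubgroup.mem_bot).mp hmem)
    exact hc0 (by rw [← hz, hz0, map_zero])
  exact X4RankZero.bsdp_three_potMult_of_selmerGroup_ne_bot_noL20 W hKatoS hDel hGZK hmod hmodD hKatoχ
    hCT hr hX hsurj hj hq hv hSel

end Summit.BirchSwinnertonDyer.Rank1Residual.Additive

end
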